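import Summits.CriticalPhenomena.PercolationContinuityZ3.Theorems.PercExchangeRateTransportCriticalCurveRegularLocModClusters
import Summits.CriticalPhenomena.PercolationContinuityZ3.Theorems.PercExchangeRateTransportCriticalCurveRegularLocModIsolation
import Summits.CriticalPhenomena.PercolationContinuityZ3.Theorems.PercExchangeRateTransportCriticalCurveRegularLocModBoxPaths

/-!
# The isolation surgery assembled: a pivotal vertical bond yields a pivotal horizontal window bond
(`stub_locModScheme` of line `locmod`, crux `CriticalCurveRegular`, stmt-CriticalPhenomena-16065 — part 3)

For a vertical bond `e = {x, x+e₃}` of `Λ_n = box 3 n` (`n ≥ 1`) pivotal for the one-arm event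
`A = {0 ↔ ∂Λ_n in Λ_n}` in a configuration `S ⊆ E(Λ_n)`, with window `Q' = Icc (x-2) (x+2)`,
`Q = Q' ∩ Λ_n`, `W = edgesTouching (zdGraph 3) Q'`, `ω' = S ∖ e`:

* entry/exit data `a, Ga, b, Gb` (part 1), a horizontal neighbour `a' = a ± e₀` of `a` in `Q`
  (`exists_horiz_nbr`), the column `Col` of vertical bonds of `Q` above/below `a'` and the set
  `T` of horizontal bonds of `Q`;
* `S' := (S ∖ W) ∪ Ga ∪ Gb ∪ Col` satisfies `S' ∉ A` (closure, part 2: `a` is a dead end) and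
  `S' ∪ T ∈ A` (explicit path `0 → a → a' → column → layer → b → ∂Λ_n`, toolkit `BoxPaths`);
* descent (part 2) gives `S ⊆ S'' ⊆ S' ∪ T`… precisely `S' ⊆ S'' ⊆ S' ∪ T` and a horizontal
  `f ∈ T ⊆ W` pivotal in `S''`, with `S''` agreeing with `S` off `W` (`isolation_scheme`).

Checked by brute force on all pivotal vertical bonds of 779 200 random configurations, `n ≤ 7`
(evidence `RESULTS.md` on the item). References: Grimmett, *Percolation* (1999), §3.3 (3.12);
Aizenman–Grimmett (1991); idea card `isolation-descent`.
-/

noncomputable section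

open Set
open Literature.Probability.Percolation Literature.Probability.LatticeModels

namespace Summit.CriticalPhenomena.PercolationContinuityZ3.Cruxes.CriticalCurveRegular.Locmod

namespace Scheme

/-! ## The window box `Q = Icc (x-2) (x+2) ∩ Λ_n` in coordinates -/

/-- Membership in `Q' ∩ Λ_n` as a coordinate box with bounds `max (-n) (xᵢ-2) ≤ yᵢ ≤ min n (xᵢ+2)`. -/
theorem mem_Q_iff {n : ℕ} {x y : Site 3} :
    (∀ j, max (-(n : ℤ)) (x j - 2) ≤ y j ∧ y j ≤ min (n : ℤ) (x j + 2)) ↔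
      y ∈ Finset.Icc (x - 2) (x + 2) ∧ y ∈ box 3 n := by
  rw [BoxPaths.mem_Icc_two_iff, mem_box]
  simp only [max_le_iff, le_min_iff]
  constructor
  · intro h
    exact ⟨fun i => ⟨(h i).1.2, (h i).2.2⟩, fun i => ⟨(h i).1.1, (h i).2.1⟩⟩
  · rintro ⟨h1, h2⟩ i
    exact ⟨⟨(h2 i).1, (h1 i).1⟩, (h2 i).2, (h1 i).2⟩

/-- Both endpoints of the bond `{x, x+e₃}` lie in the window `Icc (x-2) (x+2)`. -/
theorem endpoint_mem_Icc {x y : Site 3} (hy : y ∈ s(x, x + Pi.single (2 : Fin 3) 1)) :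
    y ∈ Finset.Icc (x - 2) (x + 2) := by
  rw [BoxPaths.mem_Icc_two_iff]
  rcases Sym2.mem_iff.1 hy with rfl | rfl
  · intro i; constructor <;> omega
  · intro i
    rcases eq_or_ne i 2 with rfl | hi
    · simp; omega
    · simp [hi]

/-- **A horizontal neighbour inside the window box.** For `n ≥ 1`, `x ∈ Λ_n` and `a ∈ Q' ∩ Λ_n`, one
of `a ± e₀` lies in `Q' ∩ Λ_n` (the box has at least three sites in direction `0`). -/
theorem exists_horiz_nbr {n : ℕ} (hn : 1 ≤ n) {x a : Site 3} (hx : x ∈ box 3 n)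
    (ha : ∀ j, max (-(n : ℤ)) (x j - 2) ≤ a j ∧ a j ≤ min (n : ℤ) (x j + 2)) :
    ∃ σ : ℤ, (σ = 1 ∨ σ = -1) ∧
      ∀ j, max (-(n : ℤ)) (x j - 2) ≤ (a + Pi.single (0 : Fin 3) σ : Site 3) j ∧
        (a + Pi.single (0 : Fin 3) σ : Site 3) j ≤ min (n : ℤ) (x j + 2) := by
  rw [mem_box] at hx
  have h0 := ha 0
  have hx0 := hx 0
  simp only [max_le_iff, le_min_iff] at h0
  by_cases hup : a 0 + 1 ≤ min (n : ℤ) (x 0 + 2)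
  · refine ⟨1, Or.inl rfl, fun j => ?_⟩
    rcases eq_or_ne j 0 with rfl | hj
    · simp only [BoxPaths.add_single_apply_same, max_le_iff, le_min_iff] at hup ⊢
      omega
    · rw [BoxPaths.add_single_apply_of_ne a hj]
      exact ha j
  · refine ⟨-1, Or.inr rfl, fun j => ?_⟩
    rcases eq_or_ne j 0 with rfl | hj
    · simp only [BoxPaths.add_single_apply_same, max_le_iff, le_min_iff] at hup ⊢
      omega
    · rw [BoxPaths.add_single_apply_of_ne a hj]
      exact ha j

/-! ## The scheme -/

/-- **The isolation scheme** (the local modification of the one-arm event on `ℤ²×ℤ`). For `n ≥ 1`,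
a vertical bond `e = {x, x+e₃}` of `Λ_n` pivotal for `{0 ↔ ∂Λ_n}` in a configuration `S` of
lattice bonds of `Λ_n`, there is a configuration `S''`, consisting of bonds of `S` and lattice bonds of
`Λ_n` touching the window `Icc (x-2) (x+2)`, agreeing with `S` off the bonds touching the window,
in which some HORIZONTAL lattice bond of `Λ_n` touching the window is pivotal. -/
theorem isolation_scheme {n : ℕ} (hn : 1 ≤ n) {x : Site 3} (hx : x ∈ box 3 n)
    {S : Finset (Sym2 (Site 3))} (hSE : ∀ g ∈ S, g ∈ (zdGraph 3).edgeSet)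
    (hpiv : IsPivotal (siteToBoundary 3 n) s(x, x + Pi.single (2 : Fin 3) 1)
      (↑S : Set (Sym2 (Site 3)))) :
    ∃ S'' : Finset (Sym2 (Site 3)),
      (∀ g ∈ S'', g ∈ S ∨ (g ∈ edgesTouching (zdGraph 3) (Finset.Icc (x - 2) (x + 2)) ∧
        ∀ y ∈ g, y ∈ box 3 n)) ∧
      (∃ f ∈ edgesTouching (zdGraph 3) (Finset.Icc (x - 2) (x + 2)),
        (∃ (y : Site 3) (i : Fin 3), i ≠ 2 ∧ f = s(y, y + Pi.single i 1) ∧ y ∈ box 3 n ∧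
          y + Pi.single i 1 ∈ box 3 n) ∧
        IsPivotal (siteToBoundary 3 n) f (↑S'' : Set (Sym2 (Site 3)))) ∧
      ∀ i, i ∉ edgesTouching (zdGraph 3) (Finset.Icc (x - 2) (x + 2)) → (i ∈ S ↔ i ∈ S'') := by
  classical
  -- names
  set e₃ : Site 3 := Pi.single 2 1 with he₃
  set Q' : Finset (Site 3) := Finset.Icc (x - 2) (x + 2) with hQ'
  set W : Finset (Sym2 (Site 3)) := edgesTouching (zdGraph 3) Q' with hWdef
  set ω' : Set (Sym2 (Site 3)) := (↑S : Set (Sym2 (Site 3))) \ {s(x, x + e₃)} with hω'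
  have hA : IsUpperSet (siteToBoundary 3 n) := DCT16.isUpperSet_siteToBoundary 3 n
  rw [ProdWeight.isPivotal_iff_of_upper hA] at hpiv
  obtain ⟨hin, hout⟩ := hpiv
  have hω'S : ω' ⊆ ↑S := Set.sdiff_subset
  have hω'E : ω' ⊆ (zdGraph 3).edgeSet := fun g hg => hSE g (hω'S hg)
  have hin' : insert s(x, x + e₃) ω' ∈ siteToBoundary 3 n := by
    rwa [hω', Set.insert_sdiff_singleton]
  have heE : s(x, x + e₃) ∈ (zdGraph 3).edgeSet := ((SimpleGraph.mem_edgeSet (zdGraph 3)).2 ((zdGraph_adj_iff x _).2 ⟨2, Or.inl rfl⟩))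
  have heW : s(x, x + e₃) ∈ W :=
    Clusters.mk_mem_edgesTouching heE (endpoint_mem_Icc (Sym2.mem_mk_left _ _))
  -- the two endpoints, entry and exit data
  obtain ⟨y₁, y₂, hy12, hC, hD⟩ := Clusters.exists_endpoints hin' hout
  have hy₁Q : y₁ ∈ Q' := endpoint_mem_Icc (by rw [← hy12]; exact Sym2.mem_mk_left _ _)
  have hy₂Q : y₂ ∈ Q' := endpoint_mem_Icc (by rw [← hy12]; exact Sym2.mem_mk_right _ _)
  obtain ⟨a, Ga, haQ, haΛ, hGaω, hGaW, haC, hpa, hGaM, hCQ⟩ := Clusters.exists_entry hω'E hy₁Q hC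
  obtain ⟨b, Gb, hbQ, hbΛ, hGbω, hGbW, hbD, hpb, hGbD⟩ := Clusters.exists_exit hω'E hy₂Q hD
  -- `C ∩ D = ∅`
  have hCD : ∀ y, PathIn (openGraph ω') ↑(box 3 n) 0 y →
      (∃ z ∈ innerBoundary (zdGraph 3) (box 3 n), PathIn (openGraph ω') ↑(box 3 n) y z) → False :=
    fun y hy ⟨z, hz, hyz⟩ => hout (DCT16.mem_siteToBoundary_iff.2 ⟨z, hz, hy.trans hyz⟩)
  have hab : a ≠ b := fun h => hCD a haC (h ▸ hbD)
  have hab' : b ≠ a := fun h => hab h.symm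
  have ha_bd : a ∉ innerBoundary (zdGraph 3) (box 3 n) := fun h =>
    hCD a haC ⟨a, h, PathIn.refl (Finset.mem_coe.2 haΛ)⟩
  -- the window box in coordinates and the neighbour `a'`
  have haQc : ∀ j, max (-(n : ℤ)) (x j - 2) ≤ a j ∧ a j ≤ min (n : ℤ) (x j + 2) :=
    mem_Q_iff.2 ⟨haQ, haΛ⟩
  have hbQc : ∀ j, max (-(n : ℤ)) (x j - 2) ≤ b j ∧ b j ≤ min (n : ℤ) (x j + 2) :=
    mem_Q_iff.2 ⟨hbQ, hbΛ⟩
  obtain ⟨σ, hσ, ha'Qc⟩ := exists_horiz_nbr hn hx haQc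
  set a' : Site 3 := a + Pi.single (0 : Fin 3) σ with ha'def
  have ha'Q : a' ∈ Q' := (mem_Q_iff.1 ha'Qc).1
  have ha'Λ : a' ∈ box 3 n := (mem_Q_iff.1 ha'Qc).2
  have ha'0 : a' 0 ≠ a 0 := by
    rw [ha'def, BoxPaths.add_single_apply_same]
    rcases hσ with rfl | rfl <;> omega
  -- the column of `a'` and the horizontal bonds of the window box
  set Col : Finset (Sym2 (Site 3)) := ((Q'.filter fun y => y ∈ box 3 n ∧ y + e₃ ∈ Q' ∧
      y + e₃ ∈ box 3 n ∧ y 0 = a' 0 ∧ y 1 = a' 1).image fun y => s(y, y + e₃)) with hColdef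
  set T : Finset (Sym2 (Site 3)) :=
    ((Q'.filter fun y => y ∈ box 3 n ∧ y + Pi.single (0 : Fin 3) 1 ∈ Q' ∧
        y + Pi.single (0 : Fin 3) 1 ∈ box 3 n).image fun y => s(y, y + Pi.single (0 : Fin 3) 1)) ∪
    ((Q'.filter fun y => y ∈ box 3 n ∧ y + Pi.single (1 : Fin 3) 1 ∈ Q' ∧
        y + Pi.single (1 : Fin 3) 1 ∈ box 3 n).image fun y => s(y, y + Pi.single (1 : Fin 3) 1))
    with hTdef
  have memCol : ∀ {g}, g ∈ Col ↔ ∃ y, (y ∈ Q' ∧ y ∈ box 3 n ∧ y + e₃ ∈ Q' ∧ y + e₃ ∈ box 3 n ∧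
      y 0 = a' 0 ∧ y 1 = a' 1) ∧ s(y, y + e₃) = g := by
    intro g
    simp only [hColdef, Finset.mem_image, Finset.mem_filter, and_assoc]
  have memT : ∀ {g}, g ∈ T ↔ ∃ (y : Site 3) (i : Fin 3), i ≠ 2 ∧ (y ∈ Q' ∧ y ∈ box 3 n ∧
      y + Pi.single i 1 ∈ Q' ∧ y + Pi.single i 1 ∈ box 3 n) ∧ s(y, y + Pi.single i 1) = g := by
    intro g
    simp only [hTdef, Finset.mem_union, Finset.mem_image, Finset.mem_filter, and_assoc]
    constructor
    · rintro (⟨y, hy1, hy2, hy3, hy4, rfl⟩ | ⟨y, hy1, hy2, hy3, hy4, rfl⟩)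
      · exact ⟨y, 0, by decide, hy1, hy2, hy3, hy4, rfl⟩
      · exact ⟨y, 1, by decide, hy1, hy2, hy3, hy4, rfl⟩
    · rintro ⟨y, i, hi, hy1, hy2, hy3, hy4, rfl⟩
      fin_cases i
      · exact Or.inl ⟨y, hy1, hy2, hy3, hy4, rfl⟩
      · exact Or.inr ⟨y, hy1, hy2, hy3, hy4, rfl⟩
      · exact absurd rfl hi
  have hColW : ∀ g ∈ Col, g ∈ W := by
    intro g hg
    obtain ⟨y, ⟨hyQ, -, -, -, -, -⟩, rfl⟩ := memCol.1 hg
    exact Clusters.mk_mem_edgesTouching (((SimpleGraph.mem_edgeSet (zdGraph 3)).2 ((zdGraph_adj_iff y _).2 ⟨2, Or.inl rfl⟩))) hyQ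
  have hTW : ∀ g ∈ T, g ∈ W := by
    intro g hg
    obtain ⟨y, i, -, ⟨hyQ, -, -, -⟩, rfl⟩ := memT.1 hg
    exact Clusters.mk_mem_edgesTouching (((SimpleGraph.mem_edgeSet (zdGraph 3)).2 ((zdGraph_adj_iff y _).2 ⟨i, Or.inl rfl⟩))) hyQ
  -- the surgery
  set X : Finset (Sym2 (Site 3)) := Ga ∪ Gb ∪ Col with hXdef
  set S' : Finset (Sym2 (Site 3)) := (S.filter fun g => g ∉ W) ∪ X with hS'def
  have hXW : ∀ g ∈ X, g ∈ W := by
    intro g hg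
    rcases Finset.mem_union.1 hg with hg | hg
    · rcases Finset.mem_union.1 hg with hg | hg
      · exact hGaW hg
      · exact hGbW hg
    · exact hColW g hg
  have hS'coe : (↑S' : Set (Sym2 (Site 3))) = (ω' \ ↑W) ∪ ↑X := by
    ext g
    simp only [hS'def, Finset.coe_union, Finset.coe_filter, Set.mem_union, Set.mem_setOf_eq,
      Set.mem_sdiff, hω', Set.mem_singleton_iff, Finset.mem_coe]
    constructor
    · rintro (⟨hgS, hgW⟩ | hgX)
      · exact Or.inl ⟨⟨hgS, fun h => hgW (h ▸ heW)⟩, hgW⟩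
      · exact Or.inr hgX
    · rintro (⟨⟨hgS, -⟩, hgW⟩ | hgX)
      · exact Or.inl ⟨hgS, hgW⟩
      · exact Or.inr hgX
  -- (i) `S' ∉ A`: closure with `M = C' ∪ {a}`
  have hnot : (↑S' : Set (Sym2 (Site 3))) ∉ siteToBoundary 3 n := by
    rw [hS'coe]
    refine Isolation.isolation_notMem hω'E hout Q' haQ ha_bd hCQ ↑X fun g hg => ?_
    rw [Finset.mem_coe] at hg
    rcases Finset.mem_union.1 hg with hg | hg
    · rcases Finset.mem_union.1 hg with hg | hg
      · exact Or.inl (hGaM g hg)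
      · -- a bond of `Gb`: its endpoints are joined to the boundary, hence off `C' ∪ {a}`
        refine Or.inr fun y hy h => ?_
        have hyD := hGbD g hg y hy
        rcases h with h | rfl
        · exact hCD y (Clusters.pathIn_mono_config Set.sdiff_subset h) hyD
        · exact hCD y haC hyD
    · -- a bond of the column of `a'`: endpoints in `Q'`, off the column of `a`
      refine Or.inr fun y hy h => ?_
      obtain ⟨c, ⟨hcQ, -, hc3Q, -, hc0, -⟩, rfl⟩ := memCol.1 hg
      have hy' : y ∈ Q' ∧ y 0 = a' 0 := by
        rcases Sym2.mem_iff.1 hy with rfl | rfl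
        · exact ⟨hcQ, hc0⟩
        · refine ⟨hc3Q, ?_⟩
          rw [← hc0]; simp [he₃]
      have hya : y ≠ a := fun hya => ha'0 (hy'.2 ▸ hya ▸ rfl)
      rcases h with h | h
      · exact hya (hCQ y h hy'.1)
      · exact hya h
  -- (ii) `S' ∪ T ∈ A`: the path `0 → a → a' → column → layer → b → ∂Λ_n`
  have hsubS' : (ω' \ ↑W) ∪ ↑X ⊆ (↑(S' ∪ T) : Set (Sym2 (Site 3))) := by
    intro g hg
    rw [← hS'coe] at hg
    exact Finset.mem_coe.2 (Finset.mem_union_left _ (Finset.mem_coe.1 hg))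
  have hGaS' : (ω' \ ↑W) ∪ ↑Ga ⊆ (↑(S' ∪ T) : Set (Sym2 (Site 3))) := by
    refine Set.Subset.trans (Set.union_subset_union_right _ ?_) hsubS'
    intro g hg; simp only [hXdef, Finset.coe_union, Set.mem_union]; exact Or.inl (Or.inl hg)
  have hGbS' : (ω' \ ↑W) ∪ ↑Gb ⊆ (↑(S' ∪ T) : Set (Sym2 (Site 3))) := by
    refine Set.Subset.trans (Set.union_subset_union_right _ ?_) hsubS'
    intro g hg; simp only [hXdef, Finset.coe_union, Set.mem_union]; exact Or.inl (Or.inr hg)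
  have hColT : (↑Col : Set (Sym2 (Site 3))) ∪ ↑T ⊆ (↑(S' ∪ T) : Set (Sym2 (Site 3))) := by
    rintro g (hg | hg)
    · refine hsubS' (Or.inr ?_)
      simp only [hXdef, Finset.coe_union, Set.mem_union]
      exact Or.inr hg
    · exact Finset.mem_coe.2 (Finset.mem_union_right _ (Finset.mem_coe.1 hg))
  have hmem : (↑(S' ∪ T) : Set (Sym2 (Site 3))) ∈ siteToBoundary 3 n := by
    rw [DCT16.mem_siteToBoundary_iff]
    obtain ⟨z, hz, hpbz⟩ := hpb
    refine ⟨z, hz, ?_⟩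
    -- `0 → a`
    have h1 : PathIn (openGraph ↑(S' ∪ T)) ↑(box 3 n) 0 a := Clusters.pathIn_mono_config hGaS' hpa
    -- `a → a'` (a horizontal bond of the window box, in `T`)
    have haa'T : s(a, a') ∈ T := by
      rcases hσ with rfl | rfl
      · exact memT.2 ⟨a, 0, by decide, ⟨haQ, haΛ, ha'Q, ha'Λ⟩, rfl⟩
      · refine memT.2 ⟨a', 0, by decide, ⟨ha'Q, ha'Λ, ?_, ?_⟩, ?_⟩
        · convert haQ using 1; rw [ha'def, add_assoc, ← Pi.single_add]; simp
        · convert haΛ using 1; rw [ha'def, add_assoc, ← Pi.single_add]; simp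
        · rw [Sym2.eq_swap]; congr 1; rw [ha'def, add_assoc, ← Pi.single_add]; simp
    have h2 : PathIn (openGraph ↑(S' ∪ T)) ↑(box 3 n) a a' := by
      refine PathIn.of_adj (Finset.mem_coe.2 haΛ) (Finset.mem_coe.2 ha'Λ) ?_
      rw [openGraph_adj]
      refine ⟨Finset.mem_coe.2 (Finset.mem_union_right _ haa'T), fun h => ha'0 ?_⟩
      rw [← h]
    -- `a' → b` inside the window box, through the column of `a'` and the layer of `b`
    have h3 : PathIn (openGraph ↑(S' ∪ T)) ↑(box 3 n) a' b := by
      have hp := BoxPaths.pathIn_column_then_L (ωV := ↑Col) (ωH := ↑T)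
        (fun i => max (-(n : ℤ)) (x i - 2)) (fun i => min (n : ℤ) (x i + 2)) a' b ha'Qc hbQc
        (fun c hc hc3 hc0 hc1 => ?_) (fun c i hi hc hci => ?_)
      · refine (Clusters.pathIn_mono_config hColT hp).mono fun y hy => ?_
        exact Finset.mem_coe.2 (mem_Q_iff.1 hy).2
      · -- vertical bonds of the column of `a'` inside the box are in `Col`
        have hcQ := mem_Q_iff.1 hc
        have hc3' : ∀ j, max (-(n : ℤ)) (x j - 2) ≤ (c + e₃) j ∧ (c + e₃) j ≤ min (n : ℤ) (x j + 2) := by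
          intro j
          rcases eq_or_ne j 2 with rfl | hj
          · rw [he₃, BoxPaths.add_single_apply_same]; exact hc3
          · rw [he₃, BoxPaths.add_single_apply_of_ne c hj]; exact hc j
        have hc3Q := mem_Q_iff.1 hc3'
        exact Finset.mem_coe.2 (memCol.2 ⟨c, ⟨hcQ.1, hcQ.2, hc3Q.1, hc3Q.2, hc0, hc1⟩, rfl⟩)
      · -- horizontal bonds inside the box are in `T`
        have hcQ := mem_Q_iff.1 hc
        have hci' : ∀ j, max (-(n : ℤ)) (x j - 2) ≤ (c + Pi.single i 1 : Site 3) j ∧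
            (c + Pi.single i 1 : Site 3) j ≤ min (n : ℤ) (x j + 2) := by
          intro j
          rcases eq_or_ne j i with rfl | hj
          · rw [BoxPaths.add_single_apply_same]; exact hci
          · rw [BoxPaths.add_single_apply_of_ne c hj]; exact hc j
        have hciQ := mem_Q_iff.1 hci'
        exact Finset.mem_coe.2 (memT.2 ⟨c, i, hi, ⟨hcQ.1, hcQ.2, hciQ.1, hciQ.2⟩, rfl⟩)
    -- `b → ∂Λ_n`
    have h4 : PathIn (openGraph ↑(S' ∪ T)) ↑(box 3 n) b z := Clusters.pathIn_mono_config hGbS' hpbz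
    exact h1.trans (h2.trans (h3.trans h4))
  -- (iii) descent
  obtain ⟨S'', f, hfT, hS'S'', hS''sub, hfpiv⟩ := Isolation.descent_isPivotal hA hnot hmem
  refine ⟨S'', fun g hg => ?_, ⟨f, hTW f hfT, ?_, hfpiv⟩, fun i hi => ?_⟩
  · -- every bond of `S''` is a bond of `S` or a lattice bond of `Λ_n` touching the window
    rcases Finset.mem_union.1 (hS''sub hg) with hg | hg
    · rcases Finset.mem_union.1 hg with hg | hg
      · exact Or.inl (Finset.mem_filter.1 hg).1
      · rcases Finset.mem_union.1 hg with hg' | hg'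
        · rcases Finset.mem_union.1 hg' with hg' | hg'
          · exact Or.inl (Finset.mem_coe.1 (hω'S (hGaω (Finset.mem_coe.2 hg'))))
          · exact Or.inl (Finset.mem_coe.1 (hω'S (hGbω (Finset.mem_coe.2 hg'))))
        · refine Or.inr ⟨hColW g hg', ?_⟩
          obtain ⟨y, ⟨-, hyΛ, -, hy3Λ, -, -⟩, rfl⟩ := memCol.1 hg'
          intro v hv
          rcases Sym2.mem_iff.1 hv with rfl | rfl
          · exact hyΛ
          · exact hy3Λ
    · refine Or.inr ⟨hTW g hg, ?_⟩
      obtain ⟨y, i, -, ⟨-, hyΛ, -, hyiΛ⟩, rfl⟩ := memT.1 hg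
      intro v hv
      rcases Sym2.mem_iff.1 hv with rfl | rfl
      · exact hyΛ
      · exact hyiΛ
  · obtain ⟨y, i, hi, ⟨-, hyΛ, -, hyiΛ⟩, rfl⟩ := memT.1 hfT
    exact ⟨y, i, hi, rfl, hyΛ, hyiΛ⟩
  · -- agreement off the window bonds
    constructor
    · intro hiS
      exact hS'S'' (Finset.mem_union_left _ (Finset.mem_filter.2 ⟨hiS, hi⟩))
    · intro hiS''
      rcases Finset.mem_union.1 (hS''sub hiS'') with h | h
      · rcases Finset.mem_union.1 h with h | h
        · exact (Finset.mem_filter.1 h).1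
        · exact absurd (hXW i h) hi
      · exact absurd (hTW i h) hi

end Scheme

/-! ## Registered export -/

/-- **The isolation scheme (registered helper signature of this file; = `Scheme.isolation_scheme`
with explicit binders).** -/
theorem locMod_scheme_main :
    ∀ (n : ℕ) (x : Site 3) (S : Finset (Sym2 (Site 3))), 1 ≤ n → x ∈ box 3 n →
      (∀ g ∈ S, g ∈ (zdGraph 3).edgeSet) →
      IsPivotal (siteToBoundary 3 n) s(x, x + Pi.single (2 : Fin 3) 1) (↑S : Set (Sym2 (Site 3))) →
      ∃ S'' : Finset (Sym2 (Site 3)),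
        (∀ g ∈ S'', g ∈ S ∨ (g ∈ edgesTouching (zdGraph 3) (Finset.Icc (x - 2) (x + 2)) ∧
          ∀ y ∈ g, y ∈ box 3 n)) ∧
        (∃ f ∈ edgesTouching (zdGraph 3) (Finset.Icc (x - 2) (x + 2)),
          (∃ (y : Site 3) (i : Fin 3), i ≠ 2 ∧ f = s(y, y + Pi.single i 1) ∧ y ∈ box 3 n ∧
            y + Pi.single i 1 ∈ box 3 n) ∧
          IsPivotal (siteToBoundary 3 n) f (↑S'' : Set (Sym2 (Site 3)))) ∧
        ∀ i, i ∉ edgesTouching (zdGraph 3) (Finset.Icc (x - 2) (x + 2)) → (i ∈ S ↔ i ∈ S'') :=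
  fun _ _ _ hn hx hSE hpiv => Scheme.isolation_scheme hn hx hSE hpiv

end Summit.CriticalPhenomena.PercolationContinuityZ3.Cruxes.CriticalCurveRegular.Locmod

end
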